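import Mathlib.Combinatorics.SimpleGraph.Connectivity.Connected
import Mathlib.GroupTheory.DoubleCoset
import Literature.InformationTheory.QuantumCodes.TwoBlockTannerGraph
import Literature.InformationTheory.QuantumCodes.TwoBlockGroupAlgebraCodes
import HarnessLib

/-!
# Connected components of the Tanner graph of a 2BGA code over an ARBITRARY finite group are the
# double cosets `H \ G / K` (Lin–Pryadko 2024 §IV.C; the non-abelian form of Bravyi et al. Lemma 3)

Lin–Pryadko [LinPryadko2024, §IV.C]: "the row of matrix `H_X` labeled by the group element `x ∈ G` is in
the block associated with the double coset `G_a x G_b` … Therefore, if the product of the two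
subgroups … does not contain all group elements, `G_aG_b ⊊ G` (as sets), the code `LP[a,b]` is
decomposed into smaller mutually disconnected subcodes associated with different double cosets in
`G_a \ G / G_b`. It is well known that double cosets do not necessarily have the same sizes, so the
individual double-coset subcodes are not expected to be equivalent."  Here `LP[a,b]` is the
two-block group-algebra code `H_X = [L(a) | R(b)]`, `H_Z = [R(b)ᵀ | L(a)ᵀ]` (the tree's
`TwoBlockGA.css a b`, `TwoBlockGroupAlgebraCodes.lean`, ANY finite group `G`) and `G_a = ⟨supp a⟩`.

This file proves the EXACT component structure of the Tanner graph (`TannerGraph.lean`), i.e. the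
non-abelian counterpart of [BravyiEtAl2024, Lemma 3] (`TwoBlockTannerGraph.lean`), for `a ≠ 0`,
`b ≠ 0` and WITHOUT normalising the supports: with

  `H = leftSubgroup a = ⟨s⁻¹s' : s, s' ∈ supp a⟩` (acting on the LEFT) and
  `K = rightSubgroup b = ⟨t⁻¹t' : t, t' ∈ supp b⟩` (acting on the RIGHT)

(when `1 ∈ supp a`, `1 ∈ supp b` — reachable by Lin–Pryadko Thm 6 (iv) — these are the printed
support groups `G_a`, `G_b`):

* adjacency of the 2BGA Tanner graph: `X α — L β ↔ a(αβ⁻¹) ≠ 0`, `X α — R β ↔ b(β⁻¹α) ≠ 0`,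
  `Z α — L β ↔ b(α⁻¹β) ≠ 0`, `Z α — R β ↔ a(βα⁻¹) ≠ 0`;
* the DOUBLE-COSET LABEL `L β ↦ HβK`, `X α ↦ H s₀⁻¹α K`, `Z α ↦ H αt₀ K`, `R β ↦ H s₀⁻¹βt₀ K`
  (`s₀ ∈ supp a`, `t₀ ∈ supp b`) and **`reachable_iff`**: two vertices are in one component iff their
  labels are the same double coset (Mathlib `DoubleCoset.Quotient`);
* **`tannerGraph_connected_iff`**: connected ⟺ `H·K = G` (every `g` is `h k`);
* **`componentEquivDoubleCoset : ConnectedComponent ≃ DoubleCoset.Quotient H K`** and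
  `card_connectedComponent` (`#components = |H \ G / K|`).

Unlike the abelian case the components need NOT be isomorphic ("double cosets do not necessarily have
the same sizes") — no analogue of `nonempty_iso_of_connectedComponent` is claimed.

## References (locators read on the page)
* [LinPryadko2024] H.-K. Lin, L. P. Pryadko, PRA 109 (2024) 022407 = arXiv:2306.16400, §IV.C: support
  group `G_a ≡ ⟨{g : a_g ≠ 0}⟩` (held text chunk p0009 L116–135), double-coset block structure and
  "mutually disconnected subcodes" (chunk p0010 L1–13).
* [BravyiEtAl2024] arXiv:2308.07915 §5 Lemma 3 (the abelian statement; chunk p0011 L9–19).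

No named facts, no instances, no notation. Mathlib: `DoubleCoset.Quotient`, `DoubleCoset.eq`.
-/

namespace Literature.InformationTheory.QuantumCodes

namespace TwoBlockGA

open Matrix SimpleGraph
open AbelianTwoBlock (vX vZ vL vR)

variable {G : Type*} [Group G]

/-! ### The two subgroups and the double-coset label -/

/-- `H = ⟨s⁻¹ s' : s, s' ∈ supp a⟩`, the subgroup moving `L`-qubit labels on the LEFT along
`L → X → L` steps (equal to the support group `G_a = ⟨supp a⟩` when `1 ∈ supp a`).
[cite: LinPryadko2024, §IV.C eq. "G_a ≡ ⟨{g ∈ G : a_g ≠ 0}⟩" (arXiv:2306.16400 chunk p0009 L116–121)] -/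
def leftSubgroup (a : G → ZMod 2) : Subgroup G :=
  Subgroup.closure {d | ∃ s s', a s ≠ 0 ∧ a s' ≠ 0 ∧ d = s⁻¹ * s'}

/-- `K = ⟨t⁻¹ t' : t, t' ∈ supp b⟩`, the subgroup moving `L`-qubit labels on the RIGHT along
`L → Z → L` steps (equal to `G_b = ⟨supp b⟩` when `1 ∈ supp b`).
[cite: LinPryadko2024, §IV.C (right cosets x G_b; arXiv:2306.16400 chunk p0009 L132–135)] -/
def rightSubgroup (b : G → ZMod 2) : Subgroup G :=
  Subgroup.closure {d | ∃ t t', b t ≠ 0 ∧ b t' ≠ 0 ∧ d = t⁻¹ * t'}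

/-- `s⁻¹ s' ∈ H`. [cite: LinPryadko2024, §IV.C (arXiv:2306.16400 chunk p0009 L116–121)] -/
theorem inv_mul_mem_leftSubgroup {a : G → ZMod 2} {s s' : G} (hs : a s ≠ 0) (hs' : a s' ≠ 0) :
    s⁻¹ * s' ∈ leftSubgroup a :=
  Subgroup.subset_closure ⟨s, s', hs, hs', rfl⟩

/-- `t⁻¹ t' ∈ K`. [cite: LinPryadko2024, §IV.C (arXiv:2306.16400 chunk p0009 L132–135)] -/
theorem inv_mul_mem_rightSubgroup {b : G → ZMod 2} {t t' : G} (ht : b t ≠ 0) (ht' : b t' ≠ 0) :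
    t⁻¹ * t' ∈ rightSubgroup b :=
  Subgroup.subset_closure ⟨t, t', ht, ht', rfl⟩

/-- The double-coset label of a vertex relative to base points `s₀ ∈ supp a`, `t₀ ∈ supp b`:
`L β ↦ β`, `X α ↦ s₀⁻¹α`, `Z α ↦ αt₀`, `R β ↦ s₀⁻¹βt₀` (read in `H \ G / K`).
[cite: LinPryadko2024, §IV.C "the row of H_X labeled by x is in the block associated with the double coset G_a x G_b" (arXiv:2306.16400 chunk p0010 L1–3)] -/
def dcLabel (s₀ t₀ : G) : (G ⊕ G) ⊕ (G ⊕ G) → G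
  | Sum.inl (Sum.inl α) => s₀⁻¹ * α
  | Sum.inl (Sum.inr α) => α * t₀
  | Sum.inr (Sum.inl β) => β
  | Sum.inr (Sum.inr β) => s₀⁻¹ * β * t₀

/-- `dcLabel (X α) = s₀⁻¹α`. [cite: LinPryadko2024, §IV.C (arXiv:2306.16400 chunk p0010 L1–3)] -/
@[simp] theorem dcLabel_vX (s₀ t₀ α : G) : dcLabel s₀ t₀ (vX α) = s₀⁻¹ * α := rfl

/-- `dcLabel (Z α) = αt₀`. [cite: LinPryadko2024, §IV.C (arXiv:2306.16400 chunk p0010 L1–5)] -/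
@[simp] theorem dcLabel_vZ (s₀ t₀ α : G) : dcLabel s₀ t₀ (vZ α) = α * t₀ := rfl

/-- `dcLabel (L β) = β`. [cite: LinPryadko2024, §IV.C (arXiv:2306.16400 chunk p0010 L1–3)] -/
@[simp] theorem dcLabel_vL (s₀ t₀ β : G) : dcLabel s₀ t₀ (vL β) = β := rfl

/-- `dcLabel (R β) = s₀⁻¹βt₀`. [cite: LinPryadko2024, §IV.C (arXiv:2306.16400 chunk p0010 L1–3)] -/
@[simp] theorem dcLabel_vR (s₀ t₀ β : G) : dcLabel s₀ t₀ (vR β) = s₀⁻¹ * β * t₀ := rfl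

variable [Fintype G]

/-! ### Adjacency of the 2BGA Tanner graph -/

/-- `X α — L β ↔ a(αβ⁻¹) ≠ 0` (entry `[L(a)]_{α,β}`). [cite: LinPryadko2024, §IV.A eq. (10) (arXiv:2306.16400 chunk p0009 L17–19)] -/
@[simp] theorem adj_vX_vL (a b : G → ZMod 2) (α β : G) :
    (css a b).tannerGraph.Adj (vX α) (vL β) ↔ a (α * β⁻¹) ≠ 0 := by
  simp [vX, vL]

/-- `X α — R β ↔ b(β⁻¹α) ≠ 0` (entry `[R(b)]_{α,β}`). [cite: LinPryadko2024, §IV.A eq. (10) (arXiv:2306.16400 chunk p0009 L17–19)] -/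
@[simp] theorem adj_vX_vR (a b : G → ZMod 2) (α β : G) :
    (css a b).tannerGraph.Adj (vX α) (vR β) ↔ b (β⁻¹ * α) ≠ 0 := by
  simp [vX, vR]

/-- `Z α — L β ↔ b(α⁻¹β) ≠ 0` (entry `[R(b)ᵀ]_{α,β}`). [cite: LinPryadko2024, §III eq. (5) (arXiv:2306.16400 chunk p0006 L9)] -/
@[simp] theorem adj_vZ_vL (a b : G → ZMod 2) (α β : G) :
    (css a b).tannerGraph.Adj (vZ α) (vL β) ↔ b (α⁻¹ * β) ≠ 0 := by
  simp [vZ, vL]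

/-- `Z α — R β ↔ a(βα⁻¹) ≠ 0` (entry `[L(a)ᵀ]_{α,β}`). [cite: LinPryadko2024, §III eq. (5) (arXiv:2306.16400 chunk p0006 L9)] -/
@[simp] theorem adj_vZ_vR (a b : G → ZMod 2) (α β : G) :
    (css a b).tannerGraph.Adj (vZ α) (vR β) ↔ a (β * α⁻¹) ≠ 0 := by
  simp [vZ, vR]

/-- Symmetric form of `adj_vX_vL`. [cite: LinPryadko2024, §IV.A eq. (10) (arXiv:2306.16400 chunk p0009 L17–19)] -/
@[simp] theorem adj_vL_vX (a b : G → ZMod 2) (β α : G) :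
    (css a b).tannerGraph.Adj (vL β) (vX α) ↔ a (α * β⁻¹) ≠ 0 := by
  rw [SimpleGraph.adj_comm, adj_vX_vL]

/-- Symmetric form of `adj_vX_vR`. [cite: LinPryadko2024, §IV.A eq. (10) (arXiv:2306.16400 chunk p0009 L17–19)] -/
@[simp] theorem adj_vR_vX (a b : G → ZMod 2) (β α : G) :
    (css a b).tannerGraph.Adj (vR β) (vX α) ↔ b (β⁻¹ * α) ≠ 0 := by
  rw [SimpleGraph.adj_comm, adj_vX_vR]

/-- Symmetric form of `adj_vZ_vL`. [cite: LinPryadko2024, §III eq. (5) (arXiv:2306.16400 chunk p0006 L9)] -/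
@[simp] theorem adj_vL_vZ (a b : G → ZMod 2) (β α : G) :
    (css a b).tannerGraph.Adj (vL β) (vZ α) ↔ b (α⁻¹ * β) ≠ 0 := by
  rw [SimpleGraph.adj_comm, adj_vZ_vL]

/-- Symmetric form of `adj_vZ_vR`. [cite: LinPryadko2024, §III eq. (5) (arXiv:2306.16400 chunk p0006 L9)] -/
@[simp] theorem adj_vR_vZ (a b : G → ZMod 2) (β α : G) :
    (css a b).tannerGraph.Adj (vR β) (vZ α) ↔ a (β * α⁻¹) ≠ 0 := by
  rw [SimpleGraph.adj_comm, adj_vZ_vR]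

section Label

variable {a b : G → ZMod 2} {s₀ t₀ : G} (hs₀ : a s₀ ≠ 0) (ht₀ : b t₀ ≠ 0)
include hs₀ ht₀

/-- Along an edge the double-coset label is constant in `H \ G / K`.
[cite: LinPryadko2024, §IV.C "the row of matrix H_X labeled by the group element x is in the block associated with the double coset G_a x G_b … the same is true for the x-th row of matrix H_Z" (arXiv:2306.16400 chunk p0010 L1–6)] -/
theorem dcLabel_rel_of_adj {x y : (G ⊕ G) ⊕ (G ⊕ G)} (h : (css a b).tannerGraph.Adj x y) :
    DoubleCoset.mk (leftSubgroup a) (rightSubgroup b) (dcLabel s₀ t₀ x) =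
      DoubleCoset.mk (leftSubgroup a) (rightSubgroup b) (dcLabel s₀ t₀ y) := by
  suffices key : ∀ (c : G ⊕ G) (q : G ⊕ G), (css a b).tannerGraph.Adj (Sum.inl c) (Sum.inr q) →
      DoubleCoset.mk (leftSubgroup a) (rightSubgroup b) (dcLabel s₀ t₀ (Sum.inl c)) =
        DoubleCoset.mk (leftSubgroup a) (rightSubgroup b) (dcLabel s₀ t₀ (Sum.inr q)) by
    rcases x with c | q <;> rcases y with c' | q'
    · exact absurd h (CSSCode.not_adj_check_check _ _ _)
    · exact key c q' h
    · exact (key c' q h.symm).symm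
    · exact absurd h (CSSCode.not_adj_qubit_qubit _ _ _)
  rintro (α | α) (β | β) h <;> rw [DoubleCoset.eq]
  · -- X α — L β : a(αβ⁻¹) ≠ 0 ; labels s₀⁻¹α and β = (s' ⁻¹ s₀)(s₀⁻¹ α) with s' = αβ⁻¹
    rw [adj_vX_vL] at h
    exact ⟨(α * β⁻¹)⁻¹ * s₀, inv_mul_mem_leftSubgroup h hs₀, 1, one_mem _, by
      simp only [dcLabel]; group⟩
  · -- X α — R β : b(β⁻¹α) ≠ 0 ; labels s₀⁻¹α and s₀⁻¹βt₀ = (s₀⁻¹α)·((β⁻¹α)⁻¹ t₀)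
    rw [adj_vX_vR] at h
    exact ⟨1, one_mem _, (β⁻¹ * α)⁻¹ * t₀, inv_mul_mem_rightSubgroup h ht₀, by
      simp only [dcLabel]; group⟩
  · -- Z α — L β : b(α⁻¹β) ≠ 0 ; labels αt₀ and β = (αt₀)(t₀⁻¹ (α⁻¹β))
    rw [adj_vZ_vL] at h
    exact ⟨1, one_mem _, t₀⁻¹ * (α⁻¹ * β), inv_mul_mem_rightSubgroup ht₀ h, by
      simp only [dcLabel]; group⟩
  · -- Z α — R β : a(βα⁻¹) ≠ 0 ; labels αt₀ and s₀⁻¹βt₀ = (s₀⁻¹ (βα⁻¹)) (αt₀)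
    rw [adj_vZ_vR] at h
    exact ⟨s₀⁻¹ * (β * α⁻¹), inv_mul_mem_leftSubgroup hs₀ h, 1, one_mem _, by
      simp only [dcLabel]; group⟩

/-- Along a walk the double-coset label is constant.
[cite: LinPryadko2024, §IV.C (block structure by double cosets; arXiv:2306.16400 chunk p0010 L1–10)] -/
theorem dcLabel_rel_of_reachable {x y : (G ⊕ G) ⊕ (G ⊕ G)} (h : (css a b).tannerGraph.Reachable x y) :
    DoubleCoset.mk (leftSubgroup a) (rightSubgroup b) (dcLabel s₀ t₀ x) =
      DoubleCoset.mk (leftSubgroup a) (rightSubgroup b) (dcLabel s₀ t₀ y) := by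
  obtain ⟨p⟩ := h
  induction p with
  | nil => rfl
  | cons hadj _ ih => exact (dcLabel_rel_of_adj hs₀ ht₀ hadj).trans ih

omit hs₀ ht₀ in
/-- `L β` reaches `L (hβ)` for every `h ∈ H` (length-2 paths `L → X → L`, closed under products and
inverses). [cite: LinPryadko2024, §IV.C "repeated left multiplication by a … supported on the left coset G_a x" (arXiv:2306.16400 chunk p0009 L123–127)] -/
theorem reachable_vL_leftMul {h : G} (hh : h ∈ leftSubgroup a) (β : G) :
    (css a b).tannerGraph.Reachable (vL β) (vL (h * β)) := by
  induction hh using Subgroup.closure_induction generalizing β with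
  | mem d hd =>
    obtain ⟨s, s', hs, hs', rfl⟩ := hd
    have h1 : (css a b).tannerGraph.Adj (vL β) (vX (s' * β)) := by simp [hs']
    have h2 : (css a b).tannerGraph.Adj (vX (s' * β)) (vL (s⁻¹ * s' * β)) := by
      rw [adj_vX_vL]; convert hs using 2; group
    exact h1.reachable.trans h2.reachable
  | one => simp
  | mul x y _ _ ihx ihy => rw [mul_assoc]; exact (ihy β).trans (ihx (y * β))
  | inv x _ ih => simpa using (ih (x⁻¹ * β)).symm

omit hs₀ ht₀ in
/-- `L β` reaches `L (βk)` for every `k ∈ K` (length-2 paths `L → Z → L`).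
[cite: LinPryadko2024, §IV.C "The same is true for R(b), except in this case we are dealing with the right cosets xG_b" (arXiv:2306.16400 chunk p0009 L132–135)] -/
theorem reachable_vL_mulRight {k : G} (hk : k ∈ rightSubgroup b) (β : G) :
    (css a b).tannerGraph.Reachable (vL β) (vL (β * k)) := by
  induction hk using Subgroup.closure_induction generalizing β with
  | mem d hd =>
    obtain ⟨t, t', ht, ht', rfl⟩ := hd
    have h1 : (css a b).tannerGraph.Adj (vL β) (vZ (β * t⁻¹)) := by simp [ht]
    have h2 : (css a b).tannerGraph.Adj (vZ (β * t⁻¹)) (vL (β * (t⁻¹ * t'))) := by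
      rw [adj_vZ_vL]; convert ht' using 2; group
    exact h1.reachable.trans h2.reachable
  | one => simp
  | mul x y _ _ ihx ihy => rw [← mul_assoc]; exact (ihx β).trans (ihy (β * x))
  | inv x _ ih => simpa using (ih (β * x⁻¹)).symm

/-- Every vertex is joined to the `L`-qubit carrying its label.
[cite: LinPryadko2024, §IV.C (arXiv:2306.16400 chunk p0010 L1–6)] -/
theorem reachable_vL_dcLabel (x : (G ⊕ G) ⊕ (G ⊕ G)) :
    (css a b).tannerGraph.Reachable x (vL (dcLabel s₀ t₀ x)) := by
  rcases x with (α | α) | (β | β)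
  · exact Adj.reachable (by rw [dcLabel_vX, adj_vX_vL]; convert hs₀ using 2; group)
  · exact Adj.reachable (by rw [dcLabel_vZ, adj_vZ_vL]; convert ht₀ using 2; group)
  · exact Reachable.refl _
  · have h1 : (css a b).tannerGraph.Adj (vR β) (vX (β * t₀)) := by
      rw [adj_vR_vX]; convert ht₀ using 2; group
    have h2 : (css a b).tannerGraph.Adj (vX (β * t₀)) (vL (s₀⁻¹ * β * t₀)) := by
      rw [adj_vX_vL]; convert hs₀ using 2; group
    exact h1.reachable.trans h2.reachable

/-- **Components = double cosets**: two vertices lie in one connected component iff their labels lie in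
the same double coset `H g K`.
[cite: LinPryadko2024, §IV.C "decomposed into smaller mutually disconnected subcodes associated with different double cosets in G_a\\G/G_b" (arXiv:2306.16400 chunk p0010 L6–10)] -/
theorem reachable_iff (x y : (G ⊕ G) ⊕ (G ⊕ G)) :
    (css a b).tannerGraph.Reachable x y ↔
      DoubleCoset.mk (leftSubgroup a) (rightSubgroup b) (dcLabel s₀ t₀ x) =
        DoubleCoset.mk (leftSubgroup a) (rightSubgroup b) (dcLabel s₀ t₀ y) := by
  refine ⟨dcLabel_rel_of_reachable hs₀ ht₀, fun h => ?_⟩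
  obtain ⟨h', hh', k, hk, hy⟩ := (DoubleCoset.eq _ _ _ _).mp h
  have step : (css a b).tannerGraph.Reachable (vL (dcLabel s₀ t₀ x)) (vL (dcLabel s₀ t₀ y)) := by
    rw [hy]
    exact (reachable_vL_leftMul hh' _).trans (reachable_vL_mulRight hk _)
  exact ((reachable_vL_dcLabel hs₀ ht₀ x).trans step).trans (reachable_vL_dcLabel hs₀ ht₀ y).symm

/-- **The connected components are in bijection with the double cosets `H \\ G / K`.**
[cite: LinPryadko2024, §IV.C (arXiv:2306.16400 chunk p0010 L6–13)] -/
noncomputable def componentEquivDoubleCoset :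
    (css a b).tannerGraph.ConnectedComponent ≃
      DoubleCoset.Quotient (leftSubgroup a : Set G) (rightSubgroup b) :=
  Equiv.ofBijective
    (ConnectedComponent.lift
      (fun x => DoubleCoset.mk (leftSubgroup a) (rightSubgroup b) (dcLabel s₀ t₀ x))
      (fun _ _ p _ => dcLabel_rel_of_reachable hs₀ ht₀ p.reachable))
    (by
      constructor
      · refine ConnectedComponent.ind₂ fun x y hxy => ?_
        exact ConnectedComponent.sound ((reachable_iff hs₀ ht₀ x y).mpr hxy)
      · intro q
        induction q using Quotient.inductionOn with
        | h g => exact ⟨(css a b).tannerGraph.connectedComponentMk (vL g), rfl⟩)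

end Label

variable {a b : G → ZMod 2}

/-- **Connectivity criterion for 2BGA codes over any group**: for `a ≠ 0`, `b ≠ 0` the Tanner graph of
`LP[a,b]` is connected iff `H·K = G`, i.e. every group element is a product `h k`, `h ∈ H`, `k ∈ K`
(with `1 ∈ supp a ∩ supp b`: iff `G_a G_b = G`).
[cite: LinPryadko2024, §IV.C "if the product of the two subgroups … does not contain all group elements, G_aG_b ⊊ G (as sets), the code LP[a,b] is decomposed into smaller mutually disconnected subcodes" (arXiv:2306.16400 chunk p0010 L6–10)] -/
theorem tannerGraph_connected_iff (ha : a ≠ 0) (hb : b ≠ 0) :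
    (css a b).tannerGraph.Connected ↔
      ∀ g : G, ∃ h ∈ leftSubgroup a, ∃ k ∈ rightSubgroup b, g = h * k := by
  obtain ⟨s₀, hs₀⟩ : ∃ s, a s ≠ 0 := Function.ne_iff.mp ha
  obtain ⟨t₀, ht₀⟩ : ∃ t, b t ≠ 0 := Function.ne_iff.mp hb
  rw [connected_iff_exists_forall_reachable]
  constructor
  · rintro ⟨v, hv⟩ g
    have h := (reachable_iff hs₀ ht₀ _ _).mp ((hv (vL 1)).symm.trans (hv (vL g)))
    simp only [dcLabel_vL] at h
    obtain ⟨h', hh', k, hk, hg⟩ := (DoubleCoset.eq _ _ _ _).mp h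
    exact ⟨h', hh', k, hk, by rw [hg, mul_one]⟩
  · intro h
    refine ⟨vL 1, fun w => (reachable_iff hs₀ ht₀ _ _).mpr ?_⟩
    obtain ⟨h', hh', k, hk, hg⟩ := h (dcLabel s₀ t₀ w)
    rw [DoubleCoset.eq]
    exact ⟨h', hh', k, hk, by rw [dcLabel_vL, mul_one, hg]⟩

/-- **Number of connected components = number of double cosets `|H \\ G / K|`** (which need not have
equal sizes, so the components need not be isomorphic).
[cite: LinPryadko2024, §IV.C "double cosets do not necessarily have the same sizes, so the individual double-coset subcodes are not expected to be equivalent" (arXiv:2306.16400 chunk p0010 L10–13)] -/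
theorem card_connectedComponent (ha : a ≠ 0) (hb : b ≠ 0) :
    Nat.card (css a b).tannerGraph.ConnectedComponent =
      Nat.card (DoubleCoset.Quotient (leftSubgroup a : Set G) (rightSubgroup b)) := by
  obtain ⟨s₀, hs₀⟩ : ∃ s, a s ≠ 0 := Function.ne_iff.mp ha
  obtain ⟨t₀, ht₀⟩ : ∃ t, b t ≠ 0 := Function.ne_iff.mp hb
  exact Nat.card_congr (componentEquivDoubleCoset hs₀ ht₀)

end TwoBlockGA

end Literature.InformationTheory.QuantumCodes
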